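import Summits.Ventures.DiscreteObjects.UnitDistance.FieldPlanes

/-!
# Odd unit-distance cycles in `ℚ(√d)²` for `d ≡ 3 (mod 4)`: such planes are never bipartite
(cell `pub-namedobj`, target (U), seat udg g11)

Framing (verbatim for the cell): lottery ticket; floor = certified bounds/negative ranges.

Converse direction to the bipartite clause of the 2-adic criterion (`MultiquadraticCriterion`: `χ(ℚ(√d)²) = 2` for
`d ≡ 1, 2 mod 4`).  For `d = 4k + 3` the vector `s = ((2k+1)/(2k+2), √d/(2k+2))` is a unit vector
(`(2k+1)² + d = (2k+2)²`), so the ZIGZAG `0, s, s + s̄, …` reaches `(2k+1, 0)` after `2k + 2` unit steps and returns to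
the origin along `2k + 1` horizontal unit steps: a closed walk of odd length `d` in the unit-distance graph of `K²` for
every subfield `K ∋ √d` (`not_colorable_two_plane_of_sqrt_mem_of_mod_four`: `χ(K²) ≥ 3`).  Instances: the triangle
(`d = 3`), a `7`-cycle in `ℚ(√7)²` on `(0,0), (3/4, √7/4), (3/2, 0), (9/4, √7/4), (3, 0), (2, 0), (1, 0)` (`zigzag_seven`;
Madore, arXiv:1509.07023 Prop. 4.2, proves `χ(ℚ(√7)²) ≥ 3` with a DIFFERENT `9`-cycle of step `(1/8, 3√7/8)` — erratum to the
first version of this header, which conflated the two; referee verify-ref g102), an `11`-cycle in `ℚ(√11)²`, a `15`-walk in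
`ℚ(√15)²`, … .  Hence the quadratic DICHOTOMY (with udg g11's Johnson replication): for square-free `d`,
`ℚ(√d)²` is bipartite iff `d ≢ 3 (mod 4)` (`QuadraticFieldsAtlas`).  Presumably classical (Johnson 1987 / Fischer 1990,
unread; Madore 2015 for `d = 7`); formalisation ours.  Nothing here is literature.
-/

noncomputable section

namespace Summit.Ventures.DiscreteObjects.UnitDistance

open SimpleGraph IntermediateField
open scoped IntermediateField

/-- `x`-coordinate of the `i`-th zigzag point (`d = 4k+3`). -/
def zzx (k i : ℕ) : ℝ :=
  if i ≤ 2 * k + 2 then (i : ℝ) * (2 * k + 1) / (2 * k + 2) else (2 * k + 1 : ℝ) - ((i : ℝ) - (2 * k + 2))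

/-- `y`-coordinate of the `i`-th zigzag point. -/
def zzy (k d i : ℕ) : ℝ :=
  if i ≤ 2 * k + 2 ∧ i % 2 = 1 then Real.sqrt d / (2 * k + 2) else 0

/-- The zigzag odd walk for `d = 4k+3`: `P i`, `i = 0, …, d`, with `P d = P 0`. -/
def zigzag (k d i : ℕ) : EuclideanSpace ℝ (Fin 2) := !₂[zzx k i, zzy k d i]

variable {k d : ℕ}

/-- First coordinate. -/
@[simp] theorem zigzag_apply_zero (i : ℕ) : zigzag k d i 0 = zzx k i := by simp [zigzag]

/-- Second coordinate. -/
@[simp] theorem zigzag_apply_one (i : ℕ) : zigzag k d i 1 = zzy k d i := by simp [zigzag]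

/-- The walk is closed: `P d = P 0` for `d = 4k + 3`. -/
theorem zigzag_closed (hd : d = 4 * k + 3) : zigzag k d d = zigzag k d 0 := by
  have hx : zzx k d = zzx k 0 := by
    simp only [zzx, show ¬ d ≤ 2 * k + 2 by omega, if_false, Nat.zero_le, if_true, Nat.cast_zero, zero_mul, zero_div]
    rw [hd]; push_cast; ring
  have hy : zzy k d d = zzy k d 0 := by
    simp only [zzy, show ¬ (d ≤ 2 * k + 2 ∧ d % 2 = 1) by omega, show ¬ (0 ≤ 2 * k + 2 ∧ 0 % 2 = 1) by omega,
      if_false]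
  ext j
  fin_cases j
  · simpa using hx
  · simpa using hy

/-- Squared-distance criterion for `dist = 1`. -/
theorem dist_eq_one_of_sq (p q : EuclideanSpace ℝ (Fin 2)) (h : (p 0 - q 0) ^ 2 + (p 1 - q 1) ^ 2 = 1) :
    dist p q = 1 := by
  have hd : dist p q ^ 2 = 1 := by
    rw [EuclideanSpace.dist_sq_eq, Fin.sum_univ_two, Real.dist_eq, Real.dist_eq, sq_abs, sq_abs, h]
  exact (pow_eq_one_iff_of_nonneg dist_nonneg two_ne_zero).1 hd

/-- The unit step of the zigzag: `((2k+1)/(2k+2))² + (√d/(2k+2))² = 1` for `d = 4k+3`. -/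
theorem zigzag_step_sq (hd : d = 4 * k + 3) :
    ((2 * k + 1 : ℝ) / (2 * k + 2)) ^ 2 + (Real.sqrt d / (2 * k + 2)) ^ 2 = 1 := by
  have hs : Real.sqrt d ^ 2 = (d : ℝ) := Real.sq_sqrt (Nat.cast_nonneg d)
  have hdR : (d : ℝ) = 4 * k + 3 := by rw [hd]; push_cast; ring
  have hk : (2 * k + 2 : ℝ) ≠ 0 := by positivity
  rw [div_pow, div_pow, hs, hdR]
  field_simp
  ring

/-- `x`-step on the zigzag part. -/
theorem zzx_sub_of_le {i : ℕ} (h1 : i + 1 ≤ 2 * k + 2) :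
    zzx k i - zzx k (i + 1) = -((2 * k + 1 : ℝ) / (2 * k + 2)) := by
  simp only [zzx, show i ≤ 2 * k + 2 by omega, h1, if_true]
  have hk : (2 * k + 2 : ℝ) ≠ 0 := by positivity
  push_cast
  field_simp
  ring

/-- `y`-step on the zigzag part, `i` even. -/
theorem zzy_sub_of_even {i : ℕ} (h1 : i + 1 ≤ 2 * k + 2) (hi : i % 2 = 0) :
    zzy k d i - zzy k d (i + 1) = -(Real.sqrt d / (2 * k + 2)) := by
  simp only [zzy, show ¬ (i ≤ 2 * k + 2 ∧ i % 2 = 1) by omega, show (i + 1 ≤ 2 * k + 2 ∧ (i + 1) % 2 = 1) by omega,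
    if_false, if_true, and_self]
  ring

/-- `y`-step on the zigzag part, `i` odd. -/
theorem zzy_sub_of_odd {i : ℕ} (h1 : i + 1 ≤ 2 * k + 2) (hi : i % 2 = 1) :
    zzy k d i - zzy k d (i + 1) = Real.sqrt d / (2 * k + 2) := by
  simp only [zzy, show (i ≤ 2 * k + 2 ∧ i % 2 = 1) by omega, show ¬ (i + 1 ≤ 2 * k + 2 ∧ (i + 1) % 2 = 1) by omega,
    if_false, if_true, and_self]
  ring

/-- Steps on the way back (including the corner `i = 2k+2`): `x` decreases by `1`, `y = 0`. -/
theorem zz_sub_of_ge {i : ℕ} (h1 : 2 * k + 2 ≤ i) :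
    zzx k i - zzx k (i + 1) = 1 ∧ zzy k d i - zzy k d (i + 1) = 0 := by
  constructor
  · by_cases h2 : i ≤ 2 * k + 2
    · have hi : i = 2 * k + 2 := le_antisymm h2 h1
      subst hi
      simp only [zzx, le_refl, if_true, show ¬ (2 * k + 2 + 1 ≤ 2 * k + 2) by omega, if_false]
      have hk : (2 * k + 2 : ℝ) ≠ 0 := by positivity
      push_cast
      field_simp
      ring
    · simp only [zzx, h2, show ¬ (i + 1 ≤ 2 * k + 2) by omega, if_false]
      push_cast
      ring
  · simp only [zzy, show ¬ (i ≤ 2 * k + 2 ∧ i % 2 = 1) by omega, show ¬ (i + 1 ≤ 2 * k + 2 ∧ (i + 1) % 2 = 1) by omega,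
      if_false, sub_zero]

/-- Consecutive zigzag points are at distance `1` (`d = 4k+3`; for `i ≥ d` the walk just runs on along the axis). -/
theorem dist_zigzag_succ (hd : d = 4 * k + 3) (i : ℕ) :
    dist (zigzag k d i) (zigzag k d (i + 1)) = 1 := by
  apply dist_eq_one_of_sq
  rw [zigzag_apply_zero, zigzag_apply_zero, zigzag_apply_one, zigzag_apply_one]
  have hstep := zigzag_step_sq hd
  by_cases h1 : i + 1 ≤ 2 * k + 2
  · rw [zzx_sub_of_le h1]
    rcases Nat.even_or_odd i with ⟨m, hm⟩ | ⟨m, hm⟩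
    · rw [zzy_sub_of_even h1 (by omega), neg_sq, neg_sq]; exact hstep
    · rw [zzy_sub_of_odd h1 (by omega), neg_sq]; exact hstep
  · obtain ⟨hx, hy⟩ := zz_sub_of_ge (k := k) (d := d) (i := i) (by omega)
    rw [hx, hy]; norm_num

/-- The zigzag points lie in `K²` whenever `√d ∈ K`. -/
theorem zigzag_mem (K : IntermediateField ℚ ℝ) (h : Real.sqrt d ∈ K) (i : ℕ) : zigzag k d i ∈ fieldPoints K := by
  have h2k : (2 * k + 2 : ℝ) ∈ K := add_mem (mul_mem (ofNat_mem K 2) (_root_.natCast_mem K k)) (ofNat_mem K 2)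
  have h2k1 : (2 * k + 1 : ℝ) ∈ K := add_mem (mul_mem (ofNat_mem K 2) (_root_.natCast_mem K k)) (one_mem K)
  have hx : zzx k i ∈ K := by
    unfold zzx
    split_ifs
    · exact div_mem (mul_mem (_root_.natCast_mem K i) h2k1) h2k
    · exact sub_mem h2k1 (sub_mem (_root_.natCast_mem K i) h2k)
  have hy : zzy k d i ∈ K := by
    unfold zzy
    split_ifs
    · exact div_mem h h2k
    · exact zero_mem K
  intro j
  fin_cases j
  · simpa using hx
  · simpa using hy

/-- ODD CYCLE THEOREM: if `d ≡ 3 (mod 4)` and `√d ∈ K`, the unit-distance graph of `K²` is NOT bipartite (`χ(K²) ≥ 3`). -/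
theorem not_colorable_two_plane_of_sqrt_mem_of_mod_four (d : ℕ) (hd : d % 4 = 3) (K : IntermediateField ℚ ℝ)
    (h : Real.sqrt d ∈ K) : ¬ (planeUnitDistanceGraph.induce (fieldPoints K)).Colorable 2 := by
  rintro ⟨C⟩
  set k := d / 4 with hk
  have hd' : d = 4 * k + 3 := by omega
  -- the colours along the walk
  let g : ℕ → Fin 2 := fun i => C ⟨zigzag k d i, zigzag_mem K h i⟩
  have hstep : ∀ i, g i ≠ g (i + 1) := by
    intro i
    exact C.valid (show (planeUnitDistanceGraph.induce (fieldPoints K)).Adj _ _ from dist_zigzag_succ hd' i)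
  have key : ∀ x y z : Fin 2, x ≠ y → (y = z ↔ ¬ x = z) := by decide
  -- parity propagation along the walk
  have hpar : ∀ i, i ≤ d → (g i = g 0 ↔ i % 2 = 0) := by
    intro i
    induction i with
    | zero => intro; simp
    | succ n ih =>
      intro hn
      have h1 := ih (by omega)
      have h2 := key _ _ (g 0) (hstep n)
      rw [h2, h1]
      omega
  have hclosed : g d = g 0 := by
    simp only [g]
    congr 1
    exact Subtype.ext (zigzag_closed hd')
  have := (hpar d le_rfl).1 hclosed
  omega

/-- In particular `χ(ℚ(√d)²) ≥ 3` for every `d ≡ 3 (mod 4)` (`d = 3`: the triangle; `d = 7`: Madore's `C₉`; `d = 11`: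
a `C₁₁`; …). -/
theorem not_colorable_two_plane_sqrt (d : ℕ) (hd : d % 4 = 3) :
    ¬ (planeUnitDistanceGraph.induce (fieldPoints ℚ⟮Real.sqrt d⟯)).Colorable 2 :=
  not_colorable_two_plane_of_sqrt_mem_of_mod_four d hd _ (mem_adjoin_simple_self ℚ _)

/-- Multiquadratic form: `χ(ℚ(√e : e ∈ S)²) ≥ 3` as soon as some `d ∈ S` is `≡ 3 (mod 4)`. -/
theorem not_colorable_two_plane_multiSqrtField {S : Finset ℕ} {d : ℕ} (hdS : d ∈ S) (hd : d % 4 = 3) :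
    ¬ (planeUnitDistanceGraph.induce (fieldPoints (multiSqrtField S))).Colorable 2 :=
  not_colorable_two_plane_of_sqrt_mem_of_mod_four d hd _ (sqrt_mem_multiSqrtField hdS)

/-- The case `d = 7` made explicit (erratum to the docstring of `not_colorable_two_plane_sqrt`, which calls it "Madore's
`C₉`"): the zigzag with `k = 1` is a closed unit walk of length SEVEN, `P 7 = P 0`, through
`(0,0), (3/4, √7/4), (3/2, 0), (9/4, √7/4), (3, 0), (2, 0), (1, 0)`; Madore's witness (Prop. 4.2) is a different `9`-cycle. -/
theorem zigzag_seven : zigzag 1 7 7 = zigzag 1 7 0 ∧ ∀ i, dist (zigzag 1 7 i) (zigzag 1 7 (i + 1)) = 1 :=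
  ⟨zigzag_closed (k := 1) (d := 7) (by norm_num), fun i => dist_zigzag_succ (k := 1) (d := 7) (by norm_num) i⟩

end Summit.Ventures.DiscreteObjects.UnitDistance
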